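import Literature.MathematicalPhysics.QuantumFieldTheory.Balaban1983to89.B16Eq133NewDeterminingSet
import Literature.MathematicalPhysics.QuantumFieldTheory.Balaban1983to89.B15PrelimIntegrations

/-!
# `Balaban1983to89.B16Eq150VariableFields` — T. Bałaban, *Large field renormalization. II. Localization,
exponentiation, and bounds for the 𝐑 operation*, Commun. Math. Phys. **122** (1989) 355–392 [Balaban1989LargeFieldII]
(cell paper B16; PDF held `paper:balaban1989-cmp122-large-field-ii`, journal page = PDF page + 354), Sect. 1 pp. 369–370
[PDF 15–16]: the identity **(1.50)** — *"Let us write explicitly the configuration U″_k, and its dependence on the variable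
fields: U″_k = U_{𝐁″_k}(V″↾_{Λᶜ}, exp ig_kBM˙(U₀^{(AL)})↾_{Λ∩Ω″˜²_{h+1}}, V″↾_{(Ω″˜²_{h+1})ᶜ}). (1.50)"* — PROVED on the
determining-set carrier of record (`…B15DeterminingSets`, `…B16Sect1Backgrounds.Sect1Data`) from its printed inputs, and
the sentence following it — *"The determining set 𝐁″_k restricted to the domain Λᶜ, and the field V″↾_{Λᶜ}, coincide with
the corresponding determining set, and the field, for the new configuration U_k."* — PROVED at the (1.33)/(1.34) instance of
record `B16Eq133NewDeterminingSet.with133`.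

statement-level skeleton of published theorems with citation tags; proofs where landed; nothing here is a claim about
the Yang–Mills mass gap

WHY (mega-formalization `lit-balaban`, block r13 = the B16 owner, gen 102; the cell lead's READING RULE FOR DEFINITION
DISPLAYS, condition (b): *"every printed sentence of the row that print USES downstream as mathematics … is a kernel
theorem"*).  Row B16.Eq1.50 so far typed only the right-hand FAMILY of (1.50) with its body (`Sect1Data.data150`,
`Sect1Data.cfg150`, r13 gen 3) and took `cfg150 B` AS `U″_k`; the identity itself — `U″_k` is the configuration
`U(𝐁″_k, V)` of [IV] (1.18)/(1.21) (`Sect1Data.cfgPP`, the object localized in (1.16)) — was not a theorem.  Print derives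
(1.50) from three inputs, all of the companion paper [IV] = [Balaban1989LargeFieldI] (renders
`…/1989-cmp122-large-field-I/…-p006,p007,p020,p021,p023-x2.png` READ AS IMAGES by this seat, gen 102):

* [IV] p. 194 [PDF 20], verbatim: *"The variables V″ are determined by, and defined on the set 𝔹″_k, i.e., V″ = V_j on Γ″_j,
  j = 0, 1, …, k − 1, k."* — the two letters `V` (the multi-scale field of [IV] (1.18)) and `V″` of the data record AGREE ON
  `𝐁″_k` ([III] (2.10), `B15DeterminingSets.AgreeOn`): hypothesis `hV` below;
* [IV] (1.81) p. 195 [PDF 21], verbatim: *"We put V″ = V′V₀ on Λ₀, V₀ = M_{𝔹″_k}(U₀). (1.81) More precisely the equality is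
  on the set 𝔹₀ = 𝔹″_k∩Λ₀"* (`Λ₀ = Λ∩Ω″˜²_{h+1}`), with [IV] p. 197 [PDF 23] *"We can also choose from the beginning the
  configuration U₀ in the AL-gauge"* and the chart letter of (1.49)–(1.50) `V′ = exp ig_kB` — i.e. ON THE BONDS OF `𝐁″_k`
  MEETING `Λ₀`, `V″ = exp(ig_kB)·M˙(U₀^{(AL)})`: hypothesis `h181` below, itself DERIVED (§3) for the chart coordinate
  `g_kB = (1/i) log V′` of r12's fluctuation field `V′ = V″V₀⁻¹` (`B15.PrelimIntegrations.fluct153`, `fluct181_eq` BY NAME)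
  from the chart's inverse property on the small fields `V′(b)` ([IV] (1.82): `|B′(b)| < δ′_k` on `𝔹₀`; the tree's
  `ExpChart` records only `exp i0 = 1`, `(1/i) log 1 = 0` and takes *"inverse properties on a neighbourhood of 1"* as
  hypotheses where needed, `B16Sect1Backgrounds.ExpChart`);
* the notation `U_𝐁(V)` of [III] (2.10)–(2.12) [Balaban1988Convergent]: the minimal configuration is a function of the field
  `V` ON `𝐁` — on the tree's carrier, where `DetBackground.U 𝐁` consumes a whole multi-scale field, this is the
  (2.10)-LOCALITY hypothesis `hloc : AgreeOn 𝐁″_k X X′ → U(𝐁″_k, X) = U(𝐁″_k, X′)` (the shape of r11's `hloc` in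
  `B14Eq216Concrete.ukBox_congr`; housed at rows B14.Eq2.12 / B11.Thm1).  §1 PROVES that this hypothesis carries no
  mathematical weight beyond the choice of carrier: every solution map of the tree's spec admits a (2.10)-local one with
  the same regular class, realising the same minimal configurations (`exists_local`).

CONTENT.  §0 bond/agreement bookkeeping.  §1 `isMinimizer_of_agreeOn`, `exists_local`.  §2 **(1.50)**: `cfgPP_eq_of_agreeOn`
(*"U″_k = U(𝐁″_k, V″)"*), `cfgPP_eq_bgPP` (the left side IS r12's (1.21) `bgPP` at `detPP = detSetTop`),
`data150_of_mem`/`data150_of_not_mem` (the (1.50) datum bond by bond), `agreeOn_data150` (the (1.50) datum IS `V″` on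
`𝐁″_k`), **`eq150`** (`U″_k = cfg150 B`), `cfg150_congr` (*"its dependence on the variable fields"*: through `B` on the
bonds of `𝐁″_k` meeting `Λ₀` only — p. 370 *"Therefore the expansions of U″_k are connected with changes made inside the
domain Λ"*), `eq150_zero` (`B = 0`: `U″_k = U⁰_k`).  §3 the (1.81) substitution from the chart: `subst181_of_chartCoord`,
`exists_chartCoord`, **`eq150_chart`**.  §4 the *"coincide"* sentence: `detSetK133_restrict_compl` (`𝐁_k↾_{Λᶜ} = 𝐁″_k↾_{Λᶜ}`
for the (1.33) set), `data150_eq_data134` (on the bonds of `𝐁″_k` not meeting `Λ` the (1.50) datum is the (1.34) datum —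
print's convention [IV] p. 195 *"bonds intersecting ∂Λ belong to 𝔹₀"* puts the `∂Λ`-crossing bonds on the `Λ` side),
both under LOCATED geometric hypotheses (`Γ″_j ∩ (Z∖Λ) = ∅` for `j ≠ k`, `(Z∖Λ)^{(k)} ⊆ Γ″_k`) and the printed side
conditions of (1.34) (p. 365 *"V′_k = 1 on Λᶜ, and V_Λ is … equal to V_k outside Λ"*), and at the instance `with133`
(`detK_with133_restrict_compl`).  §5 DISCHARGE of the located hypotheses at the [IV] (1.13) determining set
`𝐁″_k = genSetPP Ω Z″ Z h k` (r12's `B15DeterminingSets.genSetPP`) from `Z″_k ⊆ Λ` ([IV] (1.73) p. 192 `Λ = (Ω^{∼4}_{k₀+1})ᶜ ∩ Z`,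
*"obtained by adding one layer of M-cubes to Z″_k"*, `Z″_k = (Ω^{∼5}_{k₀+1})ᶜ ∩ Z` (1.10); p. 195 *"Λ ⊃ Z″_k ⊃ ⋯"*), `h < k`
and the nesting of `{Ω″_j}` (r12's `omegaPP_antitone`): `detPP_top_of_genSetPP`, `detPP_offTop_of_genSetPP`,
`coincide_of_genSetPP`, `coincide_of_detSetTop` (r12's (1.17) `detSetN_top` BY NAME).

Nothing printed is asserted as a fact: theorems only (no `def`, no `sorry`, no new axiom); every cross-paper input is an
explicit named hypothesis of the theorem that uses it.  Depends on: B16.Eq1.50, B16.Eq1.33/1.34 (this paper; `with133`,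
`data134`), [IV] (1.13), (1.18)/(1.21), (1.81), p. 194, p. 197 [Balaban1989LargeFieldI], [III] (2.10)–(2.12)
[Balaban1988Convergent].
-/

namespace Literature.MathematicalPhysics.QuantumFieldTheory.Balaban1983to89.B16Eq150VariableFields

open Literature.MathematicalPhysics.QuantumFieldTheory.Balaban1983to89
open B15DeterminingSets B16Sect1Backgrounds B16Eq133NewDeterminingSet Set

variable {P : Params}

/-! ## §0. Bonds meeting a set; agreement on a determining set ([III] (2.10)) -/

section Bookkeeping

variable {G : Type*} {j : ℕ}

/-- A bond meets `S` iff one of its end-points lies in `S` (READING (b) of `B15DeterminingSets`, definitional).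
[cite: Balaban1987RG1, (0.1) p.251] -/
theorem mem_bondsOf_iff {S : Set (Site P j)} {b : PBond P j} : b ∈ bondsOf S ↔ b.src ∈ S ∨ b.tgt ∈ S := Iff.rfl

/-- More points, more bonds meeting them. [cite: Balaban1987RG1, (0.1) p.251] -/
theorem bondsOf_mono {S T : Set (Site P j)} (h : S ⊆ T) : bondsOf S ⊆ bondsOf T :=
  fun _ hb => hb.imp (fun h' => h h') (fun h' => h h')

/-- A bond meeting `(X ∩ Y)^{(j)}` meets `X^{(j)}` (the region `Λ₀ = Λ ∩ Ω″˜²_{h+1}` of (1.50) lies in `Λ`).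
[cite: Balaban1989LargeFieldI, (1.81) p.195] -/
theorem bondsOf_pts_inter_subset_left (X Y : Set (Site P 0)) : bondsOf (pts j (X ∩ Y)) ⊆ bondsOf (pts j X) :=
  bondsOf_mono fun _ hy => hy.1

/-- (2.10)-agreement is reflexive. [cite: Balaban1988Convergent, (2.10) p.256] -/
theorem agreeOn_refl (𝔹 : DetSet P) (V : MSField P G) : AgreeOn 𝔹 V V := fun _ _ _ => rfl

/-- (2.10)-agreement is symmetric. [cite: Balaban1988Convergent, (2.10) p.256] -/
theorem agreeOn_symm {𝔹 : DetSet P} {V W : MSField P G} (h : AgreeOn 𝔹 V W) : AgreeOn 𝔹 W V :=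
  fun j b hb => (h j b hb).symm

/-- (2.10)-agreement is transitive. [cite: Balaban1988Convergent, (2.10) p.256] -/
theorem agreeOn_trans {𝔹 : DetSet P} {V W X : MSField P G} (h : AgreeOn 𝔹 V W) (h' : AgreeOn 𝔹 W X) :
    AgreeOn 𝔹 V X :=
  fun j b hb => (h j b hb).trans (h' j b hb)

/-- Agreement on `𝔹` gives agreement on every restriction `𝔹 ∩ X` (the *"restricted to the domain Λᶜ"* of p. 370).
[cite: Balaban1989LargeFieldII, (1.50) p.370] -/
theorem agreeOn_restrict {𝔹 : DetSet P} (X : Set (Site P 0)) {V W : MSField P G} (h : AgreeOn 𝔹 V W) :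
    AgreeOn (𝔹.restrict X) V W :=
  fun j b hb => h j b (bondsOf_mono inter_subset_left hb)

end Bookkeeping

/-! ## §1. The (2.10)-locality of the solution map `U(𝐁, ·)` is a normalisation of the carrier -/

section Locality

variable {G : Type*} [GaugeGroup G] {av : ∀ j, Averaging P j G}

/-- The variational problem [III] (2.12) sees its datum only through the bonds of `𝐁`: two data agreeing on `𝐁` have the
same minimal configurations. [cite: Balaban1988Convergent, (2.12) p.256] -/
theorem isMinimizer_of_agreeOn {reg : Set (GaugeField P 0 G)} {𝔹 : DetSet P} {V W : MSField P G}
    {U₀ : GaugeField P 0 G} (hVW : AgreeOn 𝔹 V W) (h : IsMinimizer av reg 𝔹 V U₀) : IsMinimizer av reg 𝔹 W U₀ :=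
  ⟨h.1, fun j b hb => (h.2.1 j b hb).trans (hVW j b hb),
    fun U hU hUW => h.2.2 U hU fun j b hb => (hUW j b hb).trans (hVW j b hb).symm⟩

open Classical in
/-- **The (2.10)-locality is a normalisation.**  [III] (2.12) p. 256, verbatim: *"A regular configuration V on 𝐁 determines
the minimal orbit … A minimal configuration, i.e., an element of the unique minimal orbit, is denoted by U_𝐁(V)"* — print's
`U_𝐁(·)` is a function of the field ON `𝐁`.  On the tree's carrier (`DetBackground.U 𝐁` consumes a whole multi-scale
field) this reads: for EVERY solution map `bg` of the spec there is one with the same regular class which (i) depends on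
its datum only through the datum's values on the bonds of `𝐁`, and (ii) at every datum `V` returns `bg`'s own minimal
configuration for a datum agreeing with `V` on `𝐁` (and has the correspondingly transported domain).  Hence the
hypothesis `hloc` of §2 selects print's reading and asserts nothing about [15]. [cite: Balaban1988Convergent, (2.12) p.256] -/
theorem exists_local (bg : DetBackground P G av) :
    ∃ bg' : DetBackground P G av, bg'.reg = bg.reg ∧
      (∀ (𝔹 : DetSet P) (V W : MSField P G), AgreeOn 𝔹 V W → bg'.U 𝔹 V = bg'.U 𝔹 W) ∧
      ∀ (𝔹 : DetSet P) (V : MSField P G), ∃ W : MSField P G,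
        AgreeOn 𝔹 V W ∧ bg'.U 𝔹 V = bg.U 𝔹 W ∧ (V ∈ bg'.dom 𝔹 ↔ W ∈ bg.dom 𝔹) := by
  -- truncation of a datum to the bonds of `𝔹` (value `1` elsewhere)
  let tr : DetSet P → MSField P G → MSField P G := fun 𝔹 V j b => if b ∈ bondsOf (𝔹 j) then V j b else 1
  have htrV : ∀ (𝔹 : DetSet P) (V : MSField P G), AgreeOn 𝔹 V (tr 𝔹 V) := by
    intro 𝔹 V j b hb
    show V j b = (if b ∈ bondsOf (𝔹 j) then V j b else 1)
    rw [if_pos hb]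
  have htr : ∀ (𝔹 : DetSet P) (V W : MSField P G), AgreeOn 𝔹 V W → tr 𝔹 V = tr 𝔹 W := by
    intro 𝔹 V W h
    funext j b
    show (if b ∈ bondsOf (𝔹 j) then V j b else 1) = (if b ∈ bondsOf (𝔹 j) then W j b else 1)
    by_cases hb : b ∈ bondsOf (𝔹 j)
    · rw [if_pos hb, if_pos hb, h j b hb]
    · rw [if_neg hb, if_neg hb]
  refine ⟨⟨bg.reg, fun 𝔹 => {V | tr 𝔹 V ∈ bg.dom 𝔹}, fun 𝔹 V => bg.U 𝔹 (tr 𝔹 V), fun 𝔹 V hV => ?_⟩, rfl, ?_, ?_⟩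
  · exact isMinimizer_of_agreeOn (agreeOn_symm (htrV 𝔹 V)) (bg.isMinimizer 𝔹 (tr 𝔹 V) hV)
  · intro 𝔹 V W h
    show bg.U 𝔹 (tr 𝔹 V) = bg.U 𝔹 (tr 𝔹 W)
    rw [htr 𝔹 V W h]
  · intro 𝔹 V
    exact ⟨tr 𝔹 V, htrV 𝔹 V, rfl, Iff.rfl⟩

end Locality

/-! ## §2. (1.50): `U″_k` in the variable fields `V″`, `B` -/

section NewVariables

variable {G : Type*} [GaugeGroup G] {av : ∀ i, Averaging P i G} {𝔤 : Type*} [AddCommGroup 𝔤] [Module ℝ 𝔤]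
variable (D : Sect1Data P G av 𝔤)

/-- [IV] p. 194 [PDF 20], verbatim: *"The variables V″ are determined by, and defined on the set 𝔹″_k, i.e., V″ = V_j on Γ″_j,
j = 0, 1, …, k − 1, k."*, with [IV] (1.18)/(1.21) *"U_k^{(N)} = U″_k"*, `U_k^{(n)} = U(𝔹_k^{(n)}, V)`: the configuration
`U″_k = U(𝐁″_k, V)` of record (`Sect1Data.cfgPP`) IS `U(𝐁″_k, V″)` — under print's (2.10)-locality of `U(𝐁″_k, ·)`
(`hloc`, §1) and the quoted agreement of `V` and `V″` on `𝐁″_k` (`hV`). [cite: Balaban1989LargeFieldI, (1.21) p.181] -/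
theorem cfgPP_eq_of_agreeOn
    (hloc : ∀ X X' : MSField P G, AgreeOn D.detPP X X' → D.bg.U D.detPP X = D.bg.U D.detPP X')
    (hV : AgreeOn D.detPP D.V D.Vpp) : D.cfgPP = D.bg.U D.detPP D.Vpp :=
  hloc _ _ hV

/-- The `U″_k` of record IS r12's (1.21) configuration `B15DeterminingSets.bgPP` (*"U_k^{(N)} = U″_k"*, `U_k^{(n)} =
U(𝔹_k^{(n)}, V)`, `N = k − h`) as soon as the record's `𝐁″_k` is the (1.17)/(1.21) set `detSetTop` (definitional) — the
instance identification for the left side of (1.50). [cite: Balaban1989LargeFieldI, (1.21) p.181] -/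
theorem cfgPP_eq_bgPP {Ω Zpp : ℕ → Set (Site P 0)} {h : ℕ} (hdet : D.detPP = detSetTop Ω Zpp D.Z h D.k) :
    D.cfgPP = bgPP D.bg Ω Zpp D.Z h D.k D.V := by
  show D.bg.U D.detPP D.V = D.bg.U (detSetN Ω Zpp D.Z h D.k (D.k - h)) D.V
  rw [hdet]
  rfl

/-- The (1.50) datum bond by bond, first piece: a bond of `T^{(j)}` MEETING `Λ₀^{(j)}`, `Λ₀ = Λ∩Ω″˜²_{h+1}`, carries
`exp(ig_kB(b))·M^j(U₀^{(AL)})(b)` — verbatim *"exp ig_kBM˙(U₀^{(AL)})↾_{Λ∩Ω″˜²_{h+1}}"*. [cite: Balaban1989LargeFieldII, (1.50) p.370] -/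
theorem data150_of_mem (B : MSVecField P 𝔤) {j : ℕ} {b : PBond P j} (hb : b ∈ bondsOf (pts j (D.Λ ∩ D.ΩppT2))) :
    D.data150 B j b = D.ch.iexp ((D.gk • B) j b) * avgFamily av D.U0AL j b := by
  classical
  simp only [Sect1Data.data150, splice, spliceAt, hb, if_true]
  rfl

/-- The (1.50) datum bond by bond, the other pieces: a bond NOT meeting `Λ₀^{(j)}` carries `V″` — verbatim *"V″↾_{Λᶜ}, …,
V″↾_{(Ω″˜²_{h+1})ᶜ}"* (`Λᶜ ∪ (Ω″˜²_{h+1})ᶜ = Λ₀ᶜ`). [cite: Balaban1989LargeFieldII, (1.50) p.370] -/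
theorem data150_of_not_mem (B : MSVecField P 𝔤) {j : ℕ} {b : PBond P j} (hb : b ∉ bondsOf (pts j (D.Λ ∩ D.ΩppT2))) :
    D.data150 B j b = D.Vpp j b := by
  classical
  simp only [Sect1Data.data150, splice, spliceAt, hb, if_false]

/-- The (1.50) datum IS `V″` on `𝐁″_k` as soon as `V″ = exp(ig_kB)·M˙(U₀^{(AL)})` on the bonds of `𝐁″_k` meeting `Λ₀`
— [IV] (1.81) p. 195 *"V″ = V′V₀ on Λ₀, V₀ = M_{𝔹″_k}(U₀) … on the set 𝔹₀ = 𝔹″_k∩Λ₀"* with `U₀` in the AL-gauge ([IV]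
p. 197) and `V′ = exp ig_kB` (hypothesis `h181`; derived from the chart in §3). [cite: Balaban1989LargeFieldII, (1.50) p.370] -/
theorem agreeOn_data150 (B : MSVecField P 𝔤)
    (h181 : ∀ j, ∀ b ∈ bondsOf (D.detPP j), b ∈ bondsOf (pts j (D.Λ ∩ D.ΩppT2)) →
      D.Vpp j b = D.ch.iexp ((D.gk • B) j b) * avgFamily av D.U0AL j b) :
    AgreeOn D.detPP (D.data150 B) D.Vpp := by
  intro j b hb
  by_cases hb' : b ∈ bondsOf (pts j (D.Λ ∩ D.ΩppT2))
  · rw [data150_of_mem D B hb', h181 j b hb hb']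
  · exact data150_of_not_mem D B hb'

/-- **(1.50)** p. 370 [PDF 16], verbatim: *"Let us write explicitly the configuration U″_k, and its dependence on the variable
fields: U″_k = U_{𝐁″_k}(V″↾_{Λᶜ}, exp ig_kBM˙(U₀^{(AL)})↾_{Λ∩Ω″˜²_{h+1}}, V″↾_{(Ω″˜²_{h+1})ᶜ}). (1.50)"* — PROVED: the
configuration `U″_k = U(𝐁″_k, V)` of [IV] (1.18)/(1.21) (`Sect1Data.cfgPP`, the object of (1.16)) EQUALS the family of
record `Sect1Data.cfg150` at the chart field `B`, from [IV] p. 194 (`hV`: `V″ = V` on `𝐁″_k`), [IV] (1.81) in the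
AL-gauge with `V′ = exp ig_kB` (`h181`), and print's (2.10)-locality of `U(𝐁″_k, ·)` (`hloc`, a normalisation by
`exists_local`). [cite: Balaban1989LargeFieldII, (1.50) p.370] -/
theorem eq150
    (hloc : ∀ X X' : MSField P G, AgreeOn D.detPP X X' → D.bg.U D.detPP X = D.bg.U D.detPP X')
    (hV : AgreeOn D.detPP D.V D.Vpp) (B : MSVecField P 𝔤)
    (h181 : ∀ j, ∀ b ∈ bondsOf (D.detPP j), b ∈ bondsOf (pts j (D.Λ ∩ D.ΩppT2)) →
      D.Vpp j b = D.ch.iexp ((D.gk • B) j b) * avgFamily av D.U0AL j b) :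
    D.cfgPP = D.cfg150 B :=
  hloc _ _ (agreeOn_trans hV (agreeOn_symm (agreeOn_data150 D B h181)))

/-- *"its dependence on the variable fields"* (p. 370): `U″_k` depends on the chart field `B` only through its values on the
bonds of `𝐁″_k` meeting `Λ₀` — hence *"the expansions of U″_k are connected with changes made inside the domain Λ"*.
[cite: Balaban1989LargeFieldII, (1.50) p.370] -/
theorem cfg150_congr
    (hloc : ∀ X X' : MSField P G, AgreeOn D.detPP X X' → D.bg.U D.detPP X = D.bg.U D.detPP X')
    {B B' : MSVecField P 𝔤}
    (h : ∀ j, ∀ b ∈ bondsOf (D.detPP j), b ∈ bondsOf (pts j (D.Λ ∩ D.ΩppT2)) → B j b = B' j b) :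
    D.cfg150 B = D.cfg150 B' := by
  refine hloc _ _ fun j b hb => ?_
  by_cases hb' : b ∈ bondsOf (pts j (D.Λ ∩ D.ΩppT2))
  · rw [data150_of_mem D B hb', data150_of_mem D B' hb']
    have hB : (D.gk • B) j b = (D.gk • B') j b := by
      show D.gk • B j b = D.gk • B' j b
      rw [h j b hb hb']
    rw [hB]
  · rw [data150_of_not_mem D B hb', data150_of_not_mem D B' hb']

/-- The `B = 0` member of the family is `U⁰_k` (p. 370 *"where U⁰_k is the configuration in (1.50) with B = 0"*,
`Sect1Data.bg0k`): if `V″ = M˙(U₀^{(AL)})` on the bonds of `𝐁″_k` meeting `Λ₀` (no fluctuation), then `U″_k = U⁰_k`.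
[cite: Balaban1989LargeFieldII, (1.51) p.370] -/
theorem eq150_zero
    (hloc : ∀ X X' : MSField P G, AgreeOn D.detPP X X' → D.bg.U D.detPP X = D.bg.U D.detPP X')
    (hV : AgreeOn D.detPP D.V D.Vpp)
    (h0 : ∀ j, ∀ b ∈ bondsOf (D.detPP j), b ∈ bondsOf (pts j (D.Λ ∩ D.ΩppT2)) →
      D.Vpp j b = avgFamily av D.U0AL j b) :
    D.cfgPP = D.bg0k := by
  refine eq150 D hloc hV 0 fun j b hb hb' => ?_
  rw [h0 j b hb hb']
  show _ = D.ch.iexp (D.gk • (0 : 𝔤)) * _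
  rw [smul_zero, D.ch.iexp_zero, one_mul]

/-! ## §3. The substitution (1.81) [IV] from the exponential chart -/

/-- [IV] (1.81) p. 195 [PDF 21] AS USED IN (1.50): if `g_kB` is, on the bonds of `𝐁″_k` meeting `Λ₀`, the chart
coordinate `(1/i) log V′` of r12's fluctuation field `V′ = V″V₀⁻¹` (`B15.PrelimIntegrations.fluct153`, with
`V₀ = M˙(U₀^{(AL)})` — [IV] p. 197 *"We can also choose from the beginning the configuration U₀ in the AL-gauge"*), and the
chart inverts on the values `V′(b)` there (`exp i((1/i) log V′(b)) = V′(b)`, the small-field regime of [IV] (1.82); an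
hypothesis — `ExpChart` records no inverse law), THEN `V″ = exp(ig_kB)·M˙(U₀^{(AL)})` on those bonds — by r12's
`fluct181_eq` (*"V″ = V′V₀"*) BY NAME. [cite: Balaban1989LargeFieldI, (1.81) p.195] -/
theorem subst181_of_chartCoord (B : MSVecField P 𝔤)
    (hB : ∀ j, ∀ b ∈ bondsOf (D.detPP j), b ∈ bondsOf (pts j (D.Λ ∩ D.ΩppT2)) →
      (D.gk • B) j b = D.ch.ilog (B15.PrelimIntegrations.fluct153 (D.Vpp j) (avgFamily av D.U0AL j) b))
    (hchart : ∀ j, ∀ b ∈ bondsOf (D.detPP j), b ∈ bondsOf (pts j (D.Λ ∩ D.ΩppT2)) →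
      D.ch.iexp (D.ch.ilog (B15.PrelimIntegrations.fluct153 (D.Vpp j) (avgFamily av D.U0AL j) b)) =
        B15.PrelimIntegrations.fluct153 (D.Vpp j) (avgFamily av D.U0AL j) b) :
    ∀ j, ∀ b ∈ bondsOf (D.detPP j), b ∈ bondsOf (pts j (D.Λ ∩ D.ΩppT2)) →
      D.Vpp j b = D.ch.iexp ((D.gk • B) j b) * avgFamily av D.U0AL j b := by
  intro j b hb hb0
  rw [hB j b hb hb0, hchart j b hb hb0, B15.PrelimIntegrations.fluct181_eq]

/-- For `g_k ≠ 0` the chart field `B := g_k⁻¹·(1/i) log(V″M˙(U₀^{(AL)})⁻¹)` has `g_kB = (1/i) log V′` everywhere (print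
restricts it to `𝔹₀` and fixes a gauge, (1.49); only its values on the bonds of `𝐁″_k` meeting `Λ₀` enter (1.50),
`cfg150_congr`). [cite: Balaban1989LargeFieldI, (1.82) p.196] -/
theorem exists_chartCoord (hgk : D.gk ≠ 0) :
    ∃ B : MSVecField P 𝔤, ∀ (j : ℕ) (b : PBond P j),
      (D.gk • B) j b = D.ch.ilog (B15.PrelimIntegrations.fluct153 (D.Vpp j) (avgFamily av D.U0AL j) b) :=
  ⟨fun j b => D.gk⁻¹ • D.ch.ilog (B15.PrelimIntegrations.fluct153 (D.Vpp j) (avgFamily av D.U0AL j) b), fun j b => by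
    simp only [Pi.smul_apply, smul_smul, mul_inv_cancel₀ hgk, one_smul]⟩

/-- **(1.50) for the chart coordinate of the (1.81) fluctuation field**: with `g_k ≠ 0`, the chart inverting on the small
fields `V′(b) = V″(b)M˙(U₀^{(AL)})(b)⁻¹` on the bonds of `𝐁″_k` meeting `Λ₀`, `V″ = V` on `𝐁″_k` ([IV] p. 194) and the
(2.10)-locality of `U(𝐁″_k, ·)`, there is a chart field `B` with `g_kB = (1/i) log V′` and `U″_k = U_{𝐁″_k}(V″↾_{Λᶜ},
exp ig_kBM˙(U₀^{(AL)})↾_{Λ₀}, V″↾_{(Ω″˜²_{h+1})ᶜ})`. [cite: Balaban1989LargeFieldII, (1.50) p.370] -/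
theorem eq150_chart
    (hloc : ∀ X X' : MSField P G, AgreeOn D.detPP X X' → D.bg.U D.detPP X = D.bg.U D.detPP X')
    (hV : AgreeOn D.detPP D.V D.Vpp) (hgk : D.gk ≠ 0)
    (hchart : ∀ j, ∀ b ∈ bondsOf (D.detPP j), b ∈ bondsOf (pts j (D.Λ ∩ D.ΩppT2)) →
      D.ch.iexp (D.ch.ilog (B15.PrelimIntegrations.fluct153 (D.Vpp j) (avgFamily av D.U0AL j) b)) =
        B15.PrelimIntegrations.fluct153 (D.Vpp j) (avgFamily av D.U0AL j) b) :
    ∃ B : MSVecField P 𝔤,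
      (∀ (j : ℕ) (b : PBond P j), (D.gk • B) j b = D.ch.ilog (B15.PrelimIntegrations.fluct153 (D.Vpp j) (avgFamily av D.U0AL j) b)) ∧
        D.cfgPP = D.cfg150 B := by
  obtain ⟨B, hB⟩ := exists_chartCoord D hgk
  exact ⟨B, hB, eq150 D hloc hV B (subst181_of_chartCoord D B (fun j b _ _ => hB j b) hchart)⟩

/-! ## §4. p. 370: `𝐁″_k↾_{Λᶜ}`, `V″↾_{Λᶜ}` coincide with the determining set and the field of `U_k` -/

/-- **p. 370 l. 2–4, the determining sets** — verbatim: *"The determining set 𝐁″_k restricted to the domain Λᶜ, …, coincide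
with the corresponding determining set, …, for the new configuration U_k."* — for the (1.33) set `𝐁_k = 𝐁″_k∩Zᶜ ∪
{T^{(k)}}∩Z` (`detSetK133`): `𝐁_k ∩ Λᶜ = 𝐁″_k ∩ Λᶜ` scale by scale, under the LOCATED geometry of [IV] §1 — no member
`Γ″_j`, `j ≠ k`, has points in `Z∖Λ` (`hΓZ`), and `(Z∖Λ)^{(k)} ⊆ Γ″_k` (`hΓk`); both DISCHARGED in §5 for the [IV] (1.13)
set. [cite: Balaban1989LargeFieldII, (1.50) p.370] -/
theorem detSetK133_restrict_compl
    (hΓZ : ∀ j, j ≠ D.k → ∀ y ∈ D.detPP j, embIter j y ∈ D.Z → embIter j y ∈ D.Λ)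
    (hΓk : ∀ y : Site P D.k, embIter D.k y ∈ D.Z → embIter D.k y ∉ D.Λ → y ∈ D.detPP D.k) :
    (detSetK133 D.detPP D.Z D.k).restrict D.Λᶜ = D.detPP.restrict D.Λᶜ := by
  funext j
  ext y
  simp only [DetSet.restrict_apply, mem_inter_iff, mem_pts, mem_compl_iff]
  by_cases hj : j = D.k
  · subst hj
    rw [mem_detSetK133_self]
    constructor
    · rintro ⟨h1 | h1, h2⟩
      · exact ⟨h1, h2⟩
      · exact ⟨hΓk y h1 h2, h2⟩
    · rintro ⟨h1, h2⟩
      exact ⟨Or.inl h1, h2⟩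
  · rw [detSetK133_of_ne D.detPP D.Z hj]
    simp only [mem_inter_iff, mem_compl_iff, mem_pts]
    constructor
    · rintro ⟨⟨h1, -⟩, h2⟩
      exact ⟨h1, h2⟩
    · rintro ⟨h1, h2⟩
      exact ⟨⟨h1, fun hz => h2 (hΓZ j hj y h1 hz)⟩, h2⟩

/-- The same at the instance of record `with133 D` (its `𝐁_k` IS (1.33), `B16Eq133NewDeterminingSet.with133_detK`):
`𝐁_k ∩ Λᶜ = 𝐁″_k ∩ Λᶜ`. [cite: Balaban1989LargeFieldII, (1.50) p.370] -/
theorem detK_with133_restrict_compl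
    (hΓZ : ∀ j, j ≠ D.k → ∀ y ∈ D.detPP j, embIter j y ∈ D.Z → embIter j y ∈ D.Λ)
    (hΓk : ∀ y : Site P D.k, embIter D.k y ∈ D.Z → embIter D.k y ∉ D.Λ → y ∈ D.detPP D.k) :
    (with133 D).detK.restrict D.Λᶜ = D.detPP.restrict D.Λᶜ :=
  detSetK133_restrict_compl D hΓZ hΓk

/-- **p. 370 l. 2–4, the fields** — verbatim: *"…, and the field V″↾_{Λᶜ}, coincide with …, and the field, for the new
configuration U_k."* — on every bond of `𝐁″_k` NOT MEETING `Λ` (print's convention, [IV] p. 195: *"bonds intersecting ∂Λ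
belong to 𝔹₀"*, i.e. to the `Λ` side) the (1.50) datum equals the (1.34) datum `V` of `U_k = U_{𝐁_k}(V)`
(`Sect1Data.data134 = splice Zᶜ V″ (V′_kV_Λ)`), from: `V″ = V` on `𝐁″_k` ([IV] p. 194, `hV`), the located geometry
`hΓZ`, and the printed side conditions of (1.34) p. 365 *"Let us recall that V′_k = 1 on Λᶜ, and V_Λ is defined on the whole
set Z^{(k)}, and equal to V_k outside Λ"* (`hVk'`, `hVΛ`, on the `k`-bonds inside `Z` not meeting `Λ`).
[cite: Balaban1989LargeFieldII, (1.50) p.370] -/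
theorem data150_eq_data134 (B : MSVecField P 𝔤) (hV : AgreeOn D.detPP D.V D.Vpp)
    (hΓZ : ∀ j, j ≠ D.k → ∀ y ∈ D.detPP j, embIter j y ∈ D.Z → embIter j y ∈ D.Λ)
    (hVk' : ∀ b : PBond P D.k, b ∉ bondsOf (pts D.k D.Λ) → b ∉ bondsOf (pts D.k D.Zᶜ) → D.Vk' D.k b = 1)
    (hVΛ : ∀ b : PBond P D.k, b ∉ bondsOf (pts D.k D.Λ) → b ∉ bondsOf (pts D.k D.Zᶜ) → D.VΛ D.k b = D.V D.k b)
    {j : ℕ} {b : PBond P j} (hb : b ∈ bondsOf (D.detPP j)) (hbΛ : b ∉ bondsOf (pts j D.Λ)) :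
    D.data150 B j b = D.data134 j b := by
  rw [data150_of_not_mem D B fun h => hbΛ (bondsOf_pts_inter_subset_left D.Λ D.ΩppT2 h)]
  by_cases hbZ : b ∈ bondsOf (pts j D.Zᶜ)
  · rw [data134_of_mem D hbZ]
  · rw [data134_of_not_mem D hbZ]
    by_cases hj : j = D.k
    · subst hj
      rw [hVk' b hbΛ hbZ, hVΛ b hbΛ hbZ, one_mul]
      exact (hV D.k b hb).symm
    · exfalso
      rcases hb with hy | hy
      · have hyZ : embIter j b.src ∈ D.Z := by
          by_contra hz
          exact hbZ (Or.inl hz)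
        exact hbΛ (Or.inl (hΓZ j hj _ hy hyZ))
      · have hyZ : embIter j b.tgt ∈ D.Z := by
          by_contra hz
          exact hbZ (Or.inr hz)
        exact hbΛ (Or.inr (hΓZ j hj _ hy hyZ))

/-- The two halves together, in the shape (2.10) reads them: on the determining set `𝐁″_k ∩ Λᶜ` deprived of the bonds
crossing `∂Λ`, the data of `U″_k` ((1.50)) and of `U_k` ((1.34) on the (1.33) set) AGREE, and that determining set is
`𝐁_k ∩ Λᶜ`. [cite: Balaban1989LargeFieldII, (1.50) p.370] -/
theorem coincide (B : MSVecField P 𝔤) (hV : AgreeOn D.detPP D.V D.Vpp)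
    (hΓZ : ∀ j, j ≠ D.k → ∀ y ∈ D.detPP j, embIter j y ∈ D.Z → embIter j y ∈ D.Λ)
    (hΓk : ∀ y : Site P D.k, embIter D.k y ∈ D.Z → embIter D.k y ∉ D.Λ → y ∈ D.detPP D.k)
    (hVk' : ∀ b : PBond P D.k, b ∉ bondsOf (pts D.k D.Λ) → b ∉ bondsOf (pts D.k D.Zᶜ) → D.Vk' D.k b = 1)
    (hVΛ : ∀ b : PBond P D.k, b ∉ bondsOf (pts D.k D.Λ) → b ∉ bondsOf (pts D.k D.Zᶜ) → D.VΛ D.k b = D.V D.k b) :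
    (with133 D).detK.restrict D.Λᶜ = D.detPP.restrict D.Λᶜ ∧
      ∀ j, ∀ b ∈ bondsOf (D.detPP.restrict D.Λᶜ j), b ∉ bondsOf (pts j D.Λ) →
        D.data150 B j b = (with133 D).data134 j b := by
  refine ⟨detK_with133_restrict_compl D hΓZ hΓk, fun j b hb hbΛ => ?_⟩
  rw [with133_data134]
  exact data150_eq_data134 D B hV hΓZ hVk' hVΛ (bondsOf_mono inter_subset_left hb) hbΛ

/-! ## §5. The located geometry DISCHARGED at the [IV] (1.13) determining set `𝐁″_k = {Γ″_j}` -/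

/-- At the [IV] (1.13) set `𝐁″_k = genSetPP Ω Z″ Z h k` (`Γ″_k = (Ω″_k)^{(k)}`, `Ω″_k = (Z″ᶜ_k ∩ Z) ∪ (Ω_k ∩ Zᶜ)` by [IV]
(1.12)) with `h < k` and `Z″_k ⊆ Λ` ([IV] (1.73) p. 192: `Λ = (Ω^{∼4}_{k₀+1})ᶜ ∩ Z` is *"obtained by adding one layer of
M-cubes to Z″_k"* `= (Ω^{∼5}_{k₀+1})ᶜ ∩ Z`; p. 195 *"Λ ⊃ Z″_k ⊃ ⋯ ⊃ Z″_{h+1} ⊃ (Ω″˜²_{h+1})ᶜ"*): every `k`-point of `Z∖Λ`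
lies in `Γ″_k`. [cite: Balaban1989LargeFieldI, (1.13) p.179] -/
theorem detPP_top_of_genSetPP {Ω Zpp : ℕ → Set (Site P 0)} {h : ℕ}
    (hdet : D.detPP = genSetPP Ω Zpp D.Z h D.k) (hhk : h < D.k) (hZppΛ : Zpp D.k ⊆ D.Λ) :
    ∀ y : Site P D.k, embIter D.k y ∈ D.Z → embIter D.k y ∉ D.Λ → y ∈ D.detPP D.k := by
  intro y hyZ hyΛ
  rw [hdet]
  show y ∈ pts D.k (gammaRegion (omegaPP Ω Zpp D.Z h) D.k D.k)
  rw [gammaRegion_self, mem_pts, omegaPP_of_lt hhk]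
  exact Or.inl ⟨fun hz => hyΛ (hZppΛ hz), hyZ⟩

/-- At the [IV] (1.13) set, with `h < k`, `Z″_k ⊆ Λ` and `{Ω″_j}` nested up to `k` (the admissibility clause of [IV]
(1.12), r12's `omegaPP_antitone`): no member `Γ″_j` with `j ≠ k` has points in `Z∖Λ` — for `j < k` because `Γ″_j ⊆
(Ω″_{j+1})ᶜ ⊆ (Ω″_k)ᶜ` while `Z∖Λ ⊆ Z∖Z″_k ⊆ Ω″_k`; above `k` there are no members. [cite: Balaban1989LargeFieldI, (1.13) p.179] -/
theorem detPP_offTop_of_genSetPP {Ω Zpp : ℕ → Set (Site P 0)} {h : ℕ}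
    (hdet : D.detPP = genSetPP Ω Zpp D.Z h D.k) (hhk : h < D.k) (hZppΛ : Zpp D.k ⊆ D.Λ)
    (hanti : ∀ j, j ≤ D.k → omegaPP Ω Zpp D.Z h D.k ⊆ omegaPP Ω Zpp D.Z h j) :
    ∀ j, j ≠ D.k → ∀ y ∈ D.detPP j, embIter j y ∈ D.Z → embIter j y ∈ D.Λ := by
  intro j hj y hy hyZ
  by_contra hyΛ
  have hk : embIter j y ∈ omegaPP Ω Zpp D.Z h D.k := by
    rw [omegaPP_of_lt hhk]
    exact Or.inl ⟨fun hz => hyΛ (hZppΛ hz), hyZ⟩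
  rw [hdet] at hy
  change y ∈ pts j (gammaRegion (omegaPP Ω Zpp D.Z h) D.k j) at hy
  rw [mem_pts] at hy
  rcases lt_or_gt_of_ne hj with hjk | hkj
  · rcases Nat.eq_zero_or_pos j with rfl | hj0
    · rw [gammaRegion_zero _ hjk] at hy
      exact hy (hanti 1 (by omega) hk)
    · rw [gammaRegion_mid _ hj0 hjk] at hy
      exact hy.2 (hanti (j + 1) (by omega) hk)
  · rw [gammaRegion_of_gt _ hkj] at hy
    exact hy

/-- **The p. 370 sentence at the [IV] (1.13) determining set**: for `𝐁″_k = genSetPP Ω Z″ Z h k`, `h < k`, `Z″_k ⊆ Λ` ((1.73) [IV]),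
`{Ω″_j}` nested up to `k`, `V″ = V` on `𝐁″_k` and the (1.34) side conditions, the determining set `𝐁″_k ∩ Λᶜ` and the
datum `V″` there (off the `∂Λ`-crossing bonds) coincide with `𝐁_k ∩ Λᶜ` and the (1.34) datum of `U_k`.
[cite: Balaban1989LargeFieldII, (1.50) p.370] -/
theorem coincide_of_genSetPP {Ω Zpp : ℕ → Set (Site P 0)} {h : ℕ} (B : MSVecField P 𝔤)
    (hdet : D.detPP = genSetPP Ω Zpp D.Z h D.k) (hhk : h < D.k) (hZppΛ : Zpp D.k ⊆ D.Λ)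
    (hanti : ∀ j, j ≤ D.k → omegaPP Ω Zpp D.Z h D.k ⊆ omegaPP Ω Zpp D.Z h j)
    (hV : AgreeOn D.detPP D.V D.Vpp)
    (hVk' : ∀ b : PBond P D.k, b ∉ bondsOf (pts D.k D.Λ) → b ∉ bondsOf (pts D.k D.Zᶜ) → D.Vk' D.k b = 1)
    (hVΛ : ∀ b : PBond P D.k, b ∉ bondsOf (pts D.k D.Λ) → b ∉ bondsOf (pts D.k D.Zᶜ) → D.VΛ D.k b = D.V D.k b) :
    (with133 D).detK.restrict D.Λᶜ = D.detPP.restrict D.Λᶜ ∧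
      ∀ j, ∀ b ∈ bondsOf (D.detPP.restrict D.Λᶜ j), b ∉ bondsOf (pts j D.Λ) →
        D.data150 B j b = (with133 D).data134 j b :=
  coincide D B hV (detPP_offTop_of_genSetPP D hdet hhk hZppΛ hanti) (detPP_top_of_genSetPP D hdet hhk hZppΛ) hVk' hVΛ

/-- The same at r12's (1.17)/(1.21) set `𝐁″_k = detSetTop Ω Z″ Z h k` (= `genSetPP` by the PROVED (1.17),
`B15DeterminingSets.detSetN_top`, for `{Ω_j}` decreasing, `1 ≤ h < k` and `Z″_j ∩ Ω_j = ∅` for `h < j ≤ k`).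
[cite: Balaban1989LargeFieldI, (1.17) p.180] -/
theorem coincide_of_detSetTop {Ω Zpp : ℕ → Set (Site P 0)} {h : ℕ} (B : MSVecField P 𝔤)
    (hdet : D.detPP = detSetTop Ω Zpp D.Z h D.k) (hΩ : ∀ ⦃a b : ℕ⦄, a ≤ b → Ω b ⊆ Ω a) (hh : 0 < h) (hhk : h < D.k)
    (hdisj : ∀ j, h < j → j ≤ D.k → Disjoint (Zpp j) (Ω j)) (hZppΛ : Zpp D.k ⊆ D.Λ)
    (hanti : ∀ j, j ≤ D.k → omegaPP Ω Zpp D.Z h D.k ⊆ omegaPP Ω Zpp D.Z h j)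
    (hV : AgreeOn D.detPP D.V D.Vpp)
    (hVk' : ∀ b : PBond P D.k, b ∉ bondsOf (pts D.k D.Λ) → b ∉ bondsOf (pts D.k D.Zᶜ) → D.Vk' D.k b = 1)
    (hVΛ : ∀ b : PBond P D.k, b ∉ bondsOf (pts D.k D.Λ) → b ∉ bondsOf (pts D.k D.Zᶜ) → D.VΛ D.k b = D.V D.k b) :
    (with133 D).detK.restrict D.Λᶜ = D.detPP.restrict D.Λᶜ ∧
      ∀ j, ∀ b ∈ bondsOf (D.detPP.restrict D.Λᶜ j), b ∉ bondsOf (pts j D.Λ) →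
        D.data150 B j b = (with133 D).data134 j b :=
  coincide_of_genSetPP D B (hdet.trans (detSetN_top hΩ hh hhk hdisj)) hhk hZppΛ hanti hV hVk' hVΛ

/-- The nesting hypothesis of `coincide_of_genSetPP` in r12's form: it follows from `Antitone (omegaPP Ω Z″ Z h)`
(`B15DeterminingSets.omegaPP_antitone`, the PROVED nesting clause of [IV] (1.12)). [cite: Balaban1989LargeFieldI, (1.12) p.179] -/
theorem nested_of_antitone {Ω Zpp : ℕ → Set (Site P 0)} {h : ℕ} (hA : Antitone (omegaPP Ω Zpp D.Z h)) :
    ∀ j, j ≤ D.k → omegaPP Ω Zpp D.Z h D.k ⊆ omegaPP Ω Zpp D.Z h j :=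
  fun _ hj => hA hj

end NewVariables

end Literature.MathematicalPhysics.QuantumFieldTheory.Balaban1983to89.B16Eq150VariableFields
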